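import Literature.Geometry.Lorentzian.KerrNullFrameFlux
import HarnessLib

/-!
# The radiation field `Ψ = rΦ` in the null frame: `dΨ = r dΦ + Φ dr`, and the comparison of the
# `V`-energy density of `Φ` through a radial graph with the `p = 1` bulk quantities of `Ψ`

(family `gr`; infrastructure for the far-region `r^p`-weighted estimates behind statement **gr.S24**
— the named fact `Kerr.dafermosRodnianski_pHierarchy_scri` of `KerrDecayHierarchy.lean`;
namespace `Literature.Geometry.Lorentzian.Kerr`)

The `r^p` bulk terms control the radiation field `Ψ = rψ` (`KerrRpCoercivity.lean`:
`⅛ (mΨ)² + ⅛ |∇̸Ψ|²` for `p = 1`), whereas clause (B2) of `Kerr.dafermosRodnianski_pHierarchy_scri`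
bounds the time-integrated `V`-energy flux of `ψ` itself through the leaves `Σ̃_τ(h♯_{R₁})`. The
passage is pointwise algebra in the null frame of `KerrNullFrame.lean`: with `p^Ψ = dΨ(x)`,
`p^Φ = dΦ(x)`, `r = r(x)`,
`p^Ψ = r p^Φ + Φ(x) dr`, hence `Ψ(m) = r Φ(m) + (1 − 2H)Φ`, `Ψ(k) = r Φ(k) − Φ`,
`Ψ̸ = r Φ̸ + Φ ∇̸r` (`Kerr.frameOut_fderiv_radius_mul`, `Kerr.frameIn_fderiv_radius_mul`,
`Kerr.frameAngSq_fderiv_radius_mul`), and therefore (`|∇̸r|² ≤ a²/r²`, `0 ≤ 1 − 2H ≤ 1`)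
`(mΦ)² ≤ 2r⁻²((mΨ)² + Φ²)`, `|∇̸Φ|² ≤ 2r⁻²|∇̸Ψ|² + 2a²r⁻⁴Φ²`, `(kΦ)² ≤ 2r⁻²((kΨ)² + Φ²)`
(`Kerr.frameOut_sq_le_radiation`, `Kerr.frameAngSq_le_radiation`, `Kerr.frameIn_sq_le_radiation`).
Inserted into the upper bound of the `V`-energy density through the radial graph with conormal
`ν_c = dt* − c dr` (`Kerr.neg_sum_multiplierCurrent_timeVector_radialConormal_le`,
`KerrNullFrameFlux.lean`) this gives

* `Kerr.neg_sum_multiplierCurrent_timeVector_radialConormal_le_radiation` — for `M ≥ 0`,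
  `r ≥ 2M`, every real `c` and every `Φ` differentiable at `x`:
  `−∑ (J^V[Φ])^μ (ν_c)_μ ≤ 2r⁻² (α (mΨ)² + β |∇̸Ψ|² + γ (kΨ)²) + 2r⁻² (α + γ + β a²/r²) Φ(x)²`
  with the coefficients `α = ¼(1+c) + ¼`, `β = ½(1 + 2H + 2Hc) + ¼c²a²/r² + ½`,
  `γ = ¼(1+2H)((1+2H) − c(1−2H)) + c²(1+2H)²a²/(8r²)` of that bound: the leaf energy density
  of `ψ` is dominated by the `p = 1` bulk density of `Ψ` (weight `r⁻² · r⁰`), a transversal term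
  `(kΨ)²` whose coefficient `γ` vanishes to order `c_null − c` (plus `O(a²/r²)`), and a zeroth-order
  term `r⁻²Φ²` (Hardy along the leaf);
* `Kerr.nullSlope_le` — `c_null = (1 + 2H)/(1 − 2H) ≤ (r + 2M)/(r − 2M)` for `r > 2M` (`H ≤ M/r`),
  so that on the far parts of the leaves `Σ̃_τ(h♯_{R₁})` (`c = σ♯(r)`) the gap `c_null − c` is
  bounded by a function of `r` alone, `O(M²/r²)` (`Kerr.outgoingNullSlope_sub_scriSlope`);
* `Kerr.neg_sum_rpOneCurrent_radialConormal_le` — the density of the `p = 1` current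
  `J^{rm}[r⁻²g⁻¹, Ψ]` through `ν_c` is at most
  `r⁻¹ ((½(1+c) + ½c²) (mΨ)² + (½((1+2H) − c(1−2H)) + a²/(2r²)) |∇̸Ψ|²)` — for the dyadic step
  (B3) (`∫ q ≤ p = 2` bulk: `(r/2)(mΨ)² + |∇̸Ψ|²` per `r²`, `Kerr.rpTwo_coercivity`).

All statements are pointwise, at points with `r > 0`, for all real `a`; no named facts (D-0026).

## References

* M. Dafermos, I. Rodnianski, arXiv:0910.4957, §3 ((eq:1): the `p = 1` bulk bounds the energy flux
  through the far, null parts of the leaves; Hardy) (key `DafermosRodnianski2010ICMP`).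
* G. Moschidis, arXiv:1509.08489 = Ann. PDE 2 (2016), Thm. 5.1 (`E^{(0)}_bulk ≳` energy flux
  density through the hyperboloids) (key `Moschidis2016`).
* M. Dafermos, I. Rodnianski, Y. Shlapentokh-Rothman, arXiv:1402.7034, §3.3 (key
  `DafermosRodnianskiShlapentokhrothman2014`).
-/

noncomputable section

open Set Filter
open scoped Topology

namespace Literature.Geometry.Lorentzian.Kerr

variable {M a : ℝ} {x : E4}

/-! ### Linearity of the frame functionals -/

/-- `frameOut` is linear: `(αp + βq)(m) = α p(m) + β q(m)`. [folklore] -/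
theorem frameOut_lincomb (M a : ℝ) (x : E4) (p q : Fin 4 → ℝ) (α β : ℝ) :
    frameOut M a x (fun μ ↦ α * p μ + β * q μ) = α * frameOut M a x p + β * frameOut M a x q := by
  simp only [frameOut, Fin.sum_univ_four]; ring

/-- `frameIn` is linear. [folklore] -/
theorem frameIn_lincomb (a : ℝ) (x : E4) (p q : Fin 4 → ℝ) (α β : ℝ) :
    frameIn a x (fun μ ↦ α * p μ + β * q μ) = α * frameIn a x p + β * frameIn a x q := by
  simp only [frameIn, Fin.sum_univ_four]; ring

/-- `frameAng` is linear in the first slot. [folklore] -/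
theorem frameAng_lincomb_left (a : ℝ) (x : E4) (p q s : Fin 4 → ℝ) (α β : ℝ) :
    frameAng a x (fun μ ↦ α * p μ + β * q μ) s = α * frameAng a x p s + β * frameAng a x q s := by
  simp only [frameAng, spatialDotNull, Fin.sum_univ_three]; ring

/-- `|(αp + βq)̸|² = α²|p̸|² + 2αβ p̸·q̸ + β²|q̸|²`. [folklore] -/
theorem frameAngSq_lincomb (a : ℝ) (x : E4) (p q : Fin 4 → ℝ) (α β : ℝ) :
    frameAngSq a x (fun μ ↦ α * p μ + β * q μ) =
      α ^ 2 * frameAngSq a x p + 2 * α * β * frameAng a x p q + β ^ 2 * frameAngSq a x q := by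
  simp only [frameAngSq, frameAng, spatialDotNull, Fin.sum_univ_three]; ring

/-! ### The differential of the radiation field: `dΨ = r dΦ + Φ dr` -/

/-- **`d(rΦ)_x = r(x) dΦ_x + Φ(x) dr_x`** componentwise, for `Φ` differentiable at a point with
`r > 0`. [folklore] -/
theorem fderiv_radius_mul_apply (hx : 0 < radius a x) {Φ : E4 → ℝ} (hΦ : DifferentiableAt ℝ Φ x) (μ : Fin 4) :
    fderiv ℝ (fun y ↦ radius a y * Φ y) x (E4.basisVector μ) =
      radius a x * fderiv ℝ Φ x (E4.basisVector μ) + Φ x * fderiv ℝ (radius a) x (E4.basisVector μ) := by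
  have hr : DifferentiableAt ℝ (radius a) x := (contDiffAt_radius hx (n := 1)).differentiableAt one_ne_zero
  have h : HasFDerivAt (fun y ↦ radius a y * Φ y) (radius a x • fderiv ℝ Φ x + Φ x • fderiv ℝ (radius a) x) x :=
    hr.hasFDerivAt.mul hΦ.hasFDerivAt
  rw [h.fderiv]
  simp only [add_apply, smul_apply, smul_eq_mul]

/-- The covector `dΨ` as a linear combination of `dΦ` and `dr`. [folklore] -/
theorem fderiv_radius_mul_eq_lincomb (hx : 0 < radius a x) {Φ : E4 → ℝ} (hΦ : DifferentiableAt ℝ Φ x) :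
    (fun μ ↦ fderiv ℝ (fun y ↦ radius a y * Φ y) x (E4.basisVector μ)) =
      fun μ ↦ radius a x * fderiv ℝ Φ x (E4.basisVector μ) + Φ x * fderiv ℝ (radius a) x (E4.basisVector μ) :=
  funext fun μ ↦ fderiv_radius_mul_apply hx hΦ μ

/-- **`Ψ(m) = r Φ(m) + (1 − 2H) Φ`** (`dr(m) = 1 − 2H`). [cite: DafermosRodnianski2010ICMP, §3] -/
theorem frameOut_fderiv_radius_mul (M : ℝ) (hx : 0 < radius a x) {Φ : E4 → ℝ} (hΦ : DifferentiableAt ℝ Φ x) :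
    frameOut M a x (fun μ ↦ fderiv ℝ (fun y ↦ radius a y * Φ y) x (E4.basisVector μ)) =
      radius a x * frameOut M a x (fun μ ↦ fderiv ℝ Φ x (E4.basisVector μ)) + (1 - 2 * scalarH M a x) * Φ x := by
  rw [fderiv_radius_mul_eq_lincomb hx hΦ, frameOut_lincomb, frameOut_fderiv_radius M a hx]
  ring

/-- **`Ψ(k) = r Φ(k) − Φ`** (`dr(k) = −1`). [cite: DafermosRodnianski2010ICMP, §3] -/
theorem frameIn_fderiv_radius_mul (hx : 0 < radius a x) {Φ : E4 → ℝ} (hΦ : DifferentiableAt ℝ Φ x) :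
    frameIn a x (fun μ ↦ fderiv ℝ (fun y ↦ radius a y * Φ y) x (E4.basisVector μ)) =
      radius a x * frameIn a x (fun μ ↦ fderiv ℝ Φ x (E4.basisVector μ)) - Φ x := by
  rw [fderiv_radius_mul_eq_lincomb hx hΦ, frameIn_lincomb, frameIn_fderiv_radius hx]
  ring

/-- **`|Ψ̸|² = r²|Φ̸|² + 2rΦ (Φ̸·∇̸r) + Φ²|∇̸r|²`** (`Ψ̸ = rΦ̸ + Φ∇̸r`). [cite: DafermosRodnianski2010ICMP, §3] -/
theorem frameAngSq_fderiv_radius_mul (hx : 0 < radius a x) {Φ : E4 → ℝ} (hΦ : DifferentiableAt ℝ Φ x) :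
    frameAngSq a x (fun μ ↦ fderiv ℝ (fun y ↦ radius a y * Φ y) x (E4.basisVector μ)) =
      radius a x ^ 2 * frameAngSq a x (fun μ ↦ fderiv ℝ Φ x (E4.basisVector μ)) +
        2 * radius a x * Φ x * frameAng a x (fun μ ↦ fderiv ℝ Φ x (E4.basisVector μ))
          (fun μ ↦ fderiv ℝ (radius a) x (E4.basisVector μ)) +
        Φ x ^ 2 * frameAngSq a x (fun μ ↦ fderiv ℝ (radius a) x (E4.basisVector μ)) := by
  rw [fderiv_radius_mul_eq_lincomb hx hΦ, frameAngSq_lincomb]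

/-! ### The frame functionals of `dΦ` in terms of those of `dΨ` -/

/-- **`(mΦ)² ≤ 2r⁻²((mΨ)² + Φ²)`** for `M ≥ 0`, `r ≥ 2M` (`rΦ(m) = Ψ(m) − (1 − 2H)Φ`,
`0 ≤ 1 − 2H ≤ 1`). [cite: DafermosRodnianski2010ICMP, §3] -/
theorem frameOut_sq_le_radiation (hM : 0 ≤ M) (hx : 0 < radius a x) (hr2 : 2 * M ≤ radius a x)
    {Φ : E4 → ℝ} (hΦ : DifferentiableAt ℝ Φ x) :
    frameOut M a x (fun μ ↦ fderiv ℝ Φ x (E4.basisVector μ)) ^ 2 ≤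
      2 / radius a x ^ 2 * (frameOut M a x (fun μ ↦ fderiv ℝ (fun y ↦ radius a y * Φ y) x (E4.basisVector μ)) ^ 2 + Φ x ^ 2) := by
  have h := frameOut_fderiv_radius_mul M hx hΦ
  set uΨ := frameOut M a x (fun μ ↦ fderiv ℝ (fun y ↦ radius a y * Φ y) x (E4.basisVector μ))
  set uΦ := frameOut M a x (fun μ ↦ fderiv ℝ Φ x (E4.basisVector μ))
  set r := radius a x
  set H := scalarH M a x
  have hH0 : 0 ≤ H := scalarH_nonneg hM a x
  have hH1 : 2 * H ≤ 1 := by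
    have := scalarH_le_div hM a hx
    have h2 : M / r ≤ 2⁻¹ := by rw [div_le_iff₀ hx]; linarith
    linarith
  rw [div_mul_eq_mul_div, le_div_iff₀ (by positivity)]
  have e : uΦ ^ 2 * r ^ 2 = (uΨ - (1 - 2 * H) * Φ x) ^ 2 := by rw [h]; ring
  rw [e]
  nlinarith [sq_nonneg (uΨ + (1 - 2 * H) * Φ x), sq_nonneg (Φ x), mul_nonneg hH0 (sq_nonneg (Φ x)),
    mul_nonneg (sub_nonneg.2 hH1) (sq_nonneg (Φ x))]

/-- **`(kΦ)² ≤ 2r⁻²((kΨ)² + Φ²)`** (`rΦ(k) = Ψ(k) + Φ`). [cite: DafermosRodnianski2010ICMP, §3] -/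
theorem frameIn_sq_le_radiation (hx : 0 < radius a x) {Φ : E4 → ℝ} (hΦ : DifferentiableAt ℝ Φ x) :
    frameIn a x (fun μ ↦ fderiv ℝ Φ x (E4.basisVector μ)) ^ 2 ≤
      2 / radius a x ^ 2 * (frameIn a x (fun μ ↦ fderiv ℝ (fun y ↦ radius a y * Φ y) x (E4.basisVector μ)) ^ 2 + Φ x ^ 2) := by
  have h := frameIn_fderiv_radius_mul hx hΦ
  set vΨ := frameIn a x (fun μ ↦ fderiv ℝ (fun y ↦ radius a y * Φ y) x (E4.basisVector μ))
  set vΦ := frameIn a x (fun μ ↦ fderiv ℝ Φ x (E4.basisVector μ))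
  set r := radius a x
  rw [div_mul_eq_mul_div, le_div_iff₀ (by positivity)]
  have e : vΦ ^ 2 * r ^ 2 = (vΨ + Φ x) ^ 2 := by rw [h]; ring
  rw [e]
  nlinarith [sq_nonneg (vΨ - Φ x)]

/-- **`|∇̸Φ|² ≤ 2r⁻²|∇̸Ψ|² + 2a²r⁻⁴Φ²`** (`rΦ̸ = Ψ̸ − Φ∇̸r`, `|∇̸r|² ≤ a²/r²`).
[cite: DafermosRodnianski2010ICMP, §3] -/
theorem frameAngSq_le_radiation (M : ℝ) (hx : 0 < radius a x) {Φ : E4 → ℝ} (hΦ : DifferentiableAt ℝ Φ x) :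
    frameAngSq a x (fun μ ↦ fderiv ℝ Φ x (E4.basisVector μ)) ≤
      2 / radius a x ^ 2 * frameAngSq a x (fun μ ↦ fderiv ℝ (fun y ↦ radius a y * Φ y) x (E4.basisVector μ)) +
        2 * a ^ 2 / radius a x ^ 4 * Φ x ^ 2 := by
  have h := frameAngSq_fderiv_radius_mul hx hΦ
  set AΨ := frameAngSq a x (fun μ ↦ fderiv ℝ (fun y ↦ radius a y * Φ y) x (E4.basisVector μ))
  set AΦ := frameAngSq a x (fun μ ↦ fderiv ℝ Φ x (E4.basisVector μ))
  set B := frameAng a x (fun μ ↦ fderiv ℝ Φ x (E4.basisVector μ)) (fun μ ↦ fderiv ℝ (radius a) x (E4.basisVector μ))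
  set D := frameAngSq a x (fun μ ↦ fderiv ℝ (radius a) x (E4.basisVector μ))
  set r := radius a x
  have hA0 : 0 ≤ AΦ := frameAngSq_nonneg hx _
  have hAΨ0 : 0 ≤ AΨ := frameAngSq_nonneg hx _
  have hD0 : 0 ≤ D := frameAngSq_nonneg hx _
  have hD : D ≤ a ^ 2 / r ^ 2 := frameAngSq_fderiv_radius_le M hx
  have hB2 : B ^ 2 ≤ AΦ * D := frameAng_sq_le hx _ _
  -- `r²AΦ = AΨ − 2rΦB − Φ²D ≤ AΨ + (½ r² AΦ + 2Φ²D) − Φ²D`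
  have hcs : |2 * r * Φ x * B| ≤ 2⁻¹ * (r ^ 2 * AΦ) + 2 * (Φ x ^ 2 * D) := by
    have key : (2 * r * Φ x * B) ^ 2 ≤ (2⁻¹ * (r ^ 2 * AΦ) + 2 * (Φ x ^ 2 * D)) ^ 2 := by
      have e1 : (2 * r * Φ x * B) ^ 2 = 4 * r ^ 2 * Φ x ^ 2 * B ^ 2 := by ring
      have e2 : 4 * r ^ 2 * Φ x ^ 2 * B ^ 2 ≤ 4 * r ^ 2 * Φ x ^ 2 * (AΦ * D) := mul_le_mul_of_nonneg_left hB2 (by positivity)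
      have e3 : 4 * r ^ 2 * Φ x ^ 2 * (AΦ * D) = 4 * (2⁻¹ * (r ^ 2 * AΦ)) * (2 * (Φ x ^ 2 * D)) := by ring
      rw [e1]
      exact (e2.trans_eq e3).trans (four_mul_le_sq_add _ _)
    exact abs_le_of_sq_le_sq key (by positivity)
  have hmain : r ^ 2 * AΦ ≤ 2 * AΨ + 2 * (Φ x ^ 2 * D) := by
    have e := neg_abs_le (2 * r * Φ x * B)
    linarith [h, hcs, e]
  have hD' : Φ x ^ 2 * D ≤ Φ x ^ 2 * (a ^ 2 / r ^ 2) := mul_le_mul_of_nonneg_left hD (sq_nonneg _)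
  have hfin : r ^ 2 * AΦ ≤ 2 * AΨ + 2 * (Φ x ^ 2 * (a ^ 2 / r ^ 2)) := by linarith
  have hr0 : 0 < r := hx
  have e1 : 2 / r ^ 2 * AΨ + 2 * a ^ 2 / r ^ 4 * Φ x ^ 2 = (2 * AΨ + 2 * (Φ x ^ 2 * (a ^ 2 / r ^ 2))) / r ^ 2 := by
    field_simp
  rw [e1, le_div_iff₀ (by positivity)]
  linarith

/-! ### The `V`-energy density of `Φ` and the `p = 1` quantities of `Ψ` -/

/-- **The `V`-energy density of `Φ` through the radial graph `ν_c` is dominated by the `p = 1` bulk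
quantities of the radiation field `Ψ = rΦ`.** For `M ≥ 0`, a point `x` with `r = r(x) ≥ 2M`,
`r > 0`, every real `c` and every `Φ` differentiable at `x`, with the coefficients
`α = ¼(1+c) + ¼`, `β = ½(1 + 2H + 2Hc) + ¼c²a²/r² + ½`,
`γ = ¼(1+2H)((1+2H) − c(1−2H)) + c²(1+2H)²a²/(8r²)` of
`Kerr.neg_sum_multiplierCurrent_timeVector_radialConormal_le` (assumed nonnegative, as they are for
`0 ≤ c ≤ c_null`, `H ≥ 0`):
`−∑ (J^V[Φ])^μ (ν_c)_μ ≤ (2/r²)(α (mΨ)² + β |∇̸Ψ|² + γ (kΨ)²) + (2/r²)(α + γ + β a²/r²) Φ(x)²`.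
[cite: DafermosRodnianski2010ICMP, §3 (eq:1)] -/
theorem neg_sum_multiplierCurrent_timeVector_radialConormal_le_radiation (hM : 0 ≤ M) (hx : 0 < radius a x)
    (hr2 : 2 * M ≤ radius a x) (c : ℝ) {Φ : E4 → ℝ} (hΦ : DifferentiableAt ℝ Φ x)
    (hα : 0 ≤ 4⁻¹ * (1 + c) + 4⁻¹)
    (hβ : 0 ≤ 2⁻¹ * (1 + 2 * scalarH M a x + 2 * scalarH M a x * c) + 4⁻¹ * c ^ 2 * (a ^ 2 / radius a x ^ 2) + 2⁻¹)
    (hγ : 0 ≤ 4⁻¹ * (1 + 2 * scalarH M a x) * ((1 + 2 * scalarH M a x) - c * (1 - 2 * scalarH M a x)) +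
      c ^ 2 * (1 + 2 * scalarH M a x) ^ 2 * (a ^ 2 / radius a x ^ 2) / 8) :
    -∑ μ, KerrSchild.multiplierCurrent (inverseMetric M a) (fun y μ ↦ timeVector M a y μ) Φ x μ *
        radialConormal a x c μ ≤
      2 / radius a x ^ 2 *
          ((4⁻¹ * (1 + c) + 4⁻¹) *
              frameOut M a x (fun μ ↦ fderiv ℝ (fun y ↦ radius a y * Φ y) x (E4.basisVector μ)) ^ 2 +
            (2⁻¹ * (1 + 2 * scalarH M a x + 2 * scalarH M a x * c) + 4⁻¹ * c ^ 2 * (a ^ 2 / radius a x ^ 2) + 2⁻¹) *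
              frameAngSq a x (fun μ ↦ fderiv ℝ (fun y ↦ radius a y * Φ y) x (E4.basisVector μ)) +
            (4⁻¹ * (1 + 2 * scalarH M a x) * ((1 + 2 * scalarH M a x) - c * (1 - 2 * scalarH M a x)) +
                c ^ 2 * (1 + 2 * scalarH M a x) ^ 2 * (a ^ 2 / radius a x ^ 2) / 8) *
              frameIn a x (fun μ ↦ fderiv ℝ (fun y ↦ radius a y * Φ y) x (E4.basisVector μ)) ^ 2) +
        2 / radius a x ^ 2 *
          ((4⁻¹ * (1 + c) + 4⁻¹) +
            (4⁻¹ * (1 + 2 * scalarH M a x) * ((1 + 2 * scalarH M a x) - c * (1 - 2 * scalarH M a x)) +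
                c ^ 2 * (1 + 2 * scalarH M a x) ^ 2 * (a ^ 2 / radius a x ^ 2) / 8) +
            (2⁻¹ * (1 + 2 * scalarH M a x + 2 * scalarH M a x * c) + 4⁻¹ * c ^ 2 * (a ^ 2 / radius a x ^ 2) + 2⁻¹) *
              (a ^ 2 / radius a x ^ 2)) * Φ x ^ 2 := by
  have h0 := neg_sum_multiplierCurrent_timeVector_radialConormal_le M hx c Φ
  have h1 := frameOut_sq_le_radiation hM hx hr2 hΦ
  have h2 := frameAngSq_le_radiation M hx hΦ
  have h3 := frameIn_sq_le_radiation hx hΦ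
  set α := 4⁻¹ * (1 + c) + 4⁻¹
  set β := 2⁻¹ * (1 + 2 * scalarH M a x + 2 * scalarH M a x * c) + 4⁻¹ * c ^ 2 * (a ^ 2 / radius a x ^ 2) + 2⁻¹
  set γ := 4⁻¹ * (1 + 2 * scalarH M a x) * ((1 + 2 * scalarH M a x) - c * (1 - 2 * scalarH M a x)) +
      c ^ 2 * (1 + 2 * scalarH M a x) ^ 2 * (a ^ 2 / radius a x ^ 2) / 8
  set uΨ := frameOut M a x (fun μ ↦ fderiv ℝ (fun y ↦ radius a y * Φ y) x (E4.basisVector μ))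
  set uΦ := frameOut M a x (fun μ ↦ fderiv ℝ Φ x (E4.basisVector μ))
  set vΨ := frameIn a x (fun μ ↦ fderiv ℝ (fun y ↦ radius a y * Φ y) x (E4.basisVector μ))
  set vΦ := frameIn a x (fun μ ↦ fderiv ℝ Φ x (E4.basisVector μ))
  set AΨ := frameAngSq a x (fun μ ↦ fderiv ℝ (fun y ↦ radius a y * Φ y) x (E4.basisVector μ))
  set AΦ := frameAngSq a x (fun μ ↦ fderiv ℝ Φ x (E4.basisVector μ))
  set r := radius a x
  set ρ := 2 / r ^ 2 with hρ
  have hρ0 : 0 ≤ ρ := by positivity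
  -- multiply the three comparisons by the nonnegative coefficients
  have k1 : α * uΦ ^ 2 ≤ α * (ρ * (uΨ ^ 2 + Φ x ^ 2)) := mul_le_mul_of_nonneg_left h1 hα
  have k2 : β * AΦ ≤ β * (ρ * AΨ + 2 * a ^ 2 / r ^ 4 * Φ x ^ 2) := mul_le_mul_of_nonneg_left h2 hβ
  have k3 : γ * vΦ ^ 2 ≤ γ * (ρ * (vΨ ^ 2 + Φ x ^ 2)) := mul_le_mul_of_nonneg_left h3 hγ
  have e : 2 * a ^ 2 / r ^ 4 = ρ * (a ^ 2 / r ^ 2) := by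
    rw [hρ]; field_simp
  rw [e] at k2
  have : α * uΦ ^ 2 + β * AΦ + γ * vΦ ^ 2 ≤
      ρ * (α * uΨ ^ 2 + β * AΨ + γ * vΨ ^ 2) + ρ * (α + γ + β * (a ^ 2 / r ^ 2)) * Φ x ^ 2 := by
    nlinarith [k1, k2, k3]
  linarith [h0, this]

/-- **`c_null ≤ (r + 2M)/(r − 2M)`**: the outgoing null slope `(1 + 2H)/(1 − 2H)` of the chart is
bounded by a function of `r` alone for `r > 2M`, `M ≥ 0` (`H ≤ M/r`). [folklore] -/
theorem nullSlope_le (hM : 0 ≤ M) (hx : 0 < radius a x) (hr2 : 2 * M < radius a x) :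
    (1 + 2 * scalarH M a x) / (1 - 2 * scalarH M a x) ≤ (radius a x + 2 * M) / (radius a x - 2 * M) := by
  have hH := scalarH_le_div hM a hx
  have hH0 := scalarH_nonneg hM a x
  set r := radius a x
  set H := scalarH M a x
  have h2H : 2 * H < 1 := by
    have : M / r < 2⁻¹ := by rw [div_lt_iff₀ hx]; linarith
    linarith
  rw [div_le_div_iff₀ (by linarith) (by linarith)]
  have hHr : H * r ≤ M := by rwa [le_div_iff₀ hx] at hH
  nlinarith

/-! ### The density of the `p = 1` current through a radial graph -/

/-- **The density of the `p = 1` current `J^{rm}[r⁻²g⁻¹, Ψ]` through the radial graph `ν_c`**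
(`c ≥ 0` not needed):
`−∑ (J^{rm}[r⁻²g⁻¹, Ψ])^μ (ν_c)_μ ≤ r⁻¹ ((½(1+c) + ½c²)(mΨ)² + (½((1+2H) − c(1−2H)) + a²/(2r²))|∇̸Ψ|²)`
(`|c (mΨ)(Ψ̸·∇̸r)| ≤ ½c²(mΨ)² + ½|∇̸Ψ|² a²/r²`). On the far parts of the leaves (`c = σ♯`,
`(1+2H) − c(1−2H) = O(M²/r²)`) this is `≲ r⁻¹(mΨ)² + O((M² + a²)r⁻³)|∇̸Ψ|²`, dominated by `r⁻²` times
the left-hand side `(r/2)(mΨ)² + |∇̸Ψ|²` of `Kerr.rpTwo_coercivity`: the step `∫ E^{(1)}_bound ≲ E^{(1)}_bulk`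
of the `p = 2` estimate, clause (B3). [cite: Moschidis2016, Thm. 5.1] -/
theorem neg_sum_rpOneCurrent_radialConormal_le (M a : ℝ) (hx : 0 < radius a x) (c : ℝ) (Ψ : E4 → ℝ) :
    -∑ μ, KerrSchild.multiplierCurrent (fun y α β ↦ (radius a y ^ 2)⁻¹ * inverseMetric M a y α β)
        (fun y μ ↦ radius a y * outVector M a y μ) Ψ x μ * radialConormal a x c μ ≤
      (radius a x)⁻¹ *
        ((2⁻¹ * (1 + c) + 2⁻¹ * c ^ 2) * frameOut M a x (fun μ ↦ fderiv ℝ Ψ x (E4.basisVector μ)) ^ 2 +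
          (2⁻¹ * ((1 + 2 * scalarH M a x) - c * (1 - 2 * scalarH M a x)) + a ^ 2 / (2 * radius a x ^ 2)) *
            frameAngSq a x (fun μ ↦ fderiv ℝ Ψ x (E4.basisVector μ))) := by
  rw [neg_sum_multiplierCurrent_smul_outVector_radialConormal M a hx (fun y ↦ (radius a y ^ 2)⁻¹)
    (fun y ↦ radius a y) c Ψ]
  set p : Fin 4 → ℝ := fun μ ↦ fderiv ℝ Ψ x (E4.basisVector μ)
  set u := frameOut M a x p
  set A := frameAngSq a x p
  set B := frameAng a x p (fun μ ↦ fderiv ℝ (radius a) x (E4.basisVector μ))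
  set r := radius a x
  set H := scalarH M a x
  have hA0 : 0 ≤ A := frameAngSq_nonneg hx p
  have hB2 : B ^ 2 ≤ A * (a ^ 2 / r ^ 2) :=
    (frameAng_sq_le hx p _).trans (mul_le_mul_of_nonneg_left (frameAngSq_fderiv_radius_le M hx) hA0)
  have hcross : |c * u * B| ≤ 2⁻¹ * c ^ 2 * u ^ 2 + 2⁻¹ * (A * (a ^ 2 / r ^ 2)) := by
    have key : (c * u * B) ^ 2 ≤ (2⁻¹ * c ^ 2 * u ^ 2 + 2⁻¹ * (A * (a ^ 2 / r ^ 2))) ^ 2 := by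
      have e1 : (c * u * B) ^ 2 = c ^ 2 * u ^ 2 * B ^ 2 := by ring
      have e2 : c ^ 2 * u ^ 2 * B ^ 2 ≤ c ^ 2 * u ^ 2 * (A * (a ^ 2 / r ^ 2)) := mul_le_mul_of_nonneg_left hB2 (by positivity)
      have e3 : c ^ 2 * u ^ 2 * (A * (a ^ 2 / r ^ 2)) = 4 * (2⁻¹ * c ^ 2 * u ^ 2) * (2⁻¹ * (A * (a ^ 2 / r ^ 2))) := by ring
      rw [e1]
      exact (e2.trans_eq e3).trans (four_mul_le_sq_add _ _)
    exact abs_le_of_sq_le_sq key (by positivity)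
  have e := le_abs_self (c * u * B)
  have hr : (r ^ 2)⁻¹ * r = r⁻¹ := by field_simp
  have hfac : 0 ≤ r⁻¹ := by positivity
  have ebound : 2⁻¹ * (1 + c) * u ^ 2 + 2⁻¹ * ((1 + 2 * H) - c * (1 - 2 * H)) * A + c * u * B ≤
      (2⁻¹ * (1 + c) + 2⁻¹ * c ^ 2) * u ^ 2 + (2⁻¹ * ((1 + 2 * H) - c * (1 - 2 * H)) + a ^ 2 / (2 * r ^ 2)) * A := by
    have e2 : a ^ 2 / (2 * r ^ 2) * A = 2⁻¹ * (A * (a ^ 2 / r ^ 2)) := by ring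
    linarith [hcross, e, e2]
  calc (r ^ 2)⁻¹ * r * (2⁻¹ * (1 + c) * u ^ 2 + 2⁻¹ * ((1 + 2 * H) - c * (1 - 2 * H)) * A + c * u * B)
      = r⁻¹ * (2⁻¹ * (1 + c) * u ^ 2 + 2⁻¹ * ((1 + 2 * H) - c * (1 - 2 * H)) * A + c * u * B) := by rw [hr]
    _ ≤ r⁻¹ * ((2⁻¹ * (1 + c) + 2⁻¹ * c ^ 2) * u ^ 2 + (2⁻¹ * ((1 + 2 * H) - c * (1 - 2 * H)) + a ^ 2 / (2 * r ^ 2)) * A) :=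
        mul_le_mul_of_nonneg_left ebound hfac

end Literature.Geometry.Lorentzian.Kerr
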